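import Mathlib.NumberTheory.Padics.RingHoms
import Mathlib.GroupTheory.Index
import Mathlib.GroupTheory.Torsion
import Mathlib.LinearAlgebra.Span.Defs
import HarnessLib

/-!
# K7r crux `EllipticUnitValueSeven` (stmt-BirchSwinnertonDyer-19705), line `rubin-formula`, stub S_dict
# `stub_localMordellWeilDictSeven` (`m_loc = n + n'`): the ABSTRACT COMPACT-KUMMER INDEX CORE
# (pure group theory; cell `bsd-cm`, seat `bsd-cm-k7r-c3` g6; helper file, `--supports` 19705)

HONEST FRAMING. Nothing here is about elliptic curves, nothing is asserted about the crux, and BSD is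
not proved by any of this; a closed item closes a rung leaf of BirchSwinnertonDyer at most. This file
is the group-theoretic heart of the proof of the registered stub S_dict of the K7r value line
(`Lines/rubin-formula.lean` on item 19705): the index `p^{m_loc} = [E(K_𝔭) ⊗ ℤ_p : tors + loc_𝔭(E(K) ⊗ ℤ_p)]`
of `Literature/…/BurungaleKobayashiNakamuraOta2026/LocalBottomIndex.lean` is an index of
`ℤ_p`-spans of KUMMER FAMILIES inside `∏_k H¹(K_𝔭, E[p^k])`; here we compute such indices abstractly.

## The abstract situation (STUB-PLAN `stub_localMordellWeilDictSeven` L1–L3/L6, evidence #9 on 19705)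

* `M` an additive commutative group (`= E(L)`, the points over the local field) with NO `p`-torsion;
* `κ : M →+ ∏_k A_k` (`=` the compact Kummer map `kummerFamilyHom`, tree Part 7 of `LocalBottomIndex`)
  whose level-`k` kernel is `p^k M` (`hκ`, tree `kummerFamily_apply_eq_zero_iff`);
* the `ℤ_p`-action `act c` on `∏_k A_k` through `c ↦ (c mod p^k) ∈ ℤ` on the `k`-th factor (`hact`,
  tree `padicPi`);
* a CHART `Φ : M →+ V` into a torsion-free, `p`-adically separated `ℤ_p`-module `V` with
  `ker Φ = M_tors` (`hΦ`) and `range Φ = G` a `ℤ_p`-SUBMODULE (`hG`) — for `E(K_𝔭)`, `p` odd ramified,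
  this is `(½λ(ι⁻¹(x + σx)), ½λ'(τ⁻¹(x − σx)))` with `λ, λ' : E(ℚ_p), E'(ℚ_p) → ℤ_p` (AEC VII.6.3).

THEN (all PROVED here): torsion of `M` is `p`-divisible hence killed by `κ`; `κ` factors through `Φ`
as an INJECTIVE `ℤ_p`-LINEAR map `ψ : G → ∏_k A_k` (`ψ(c • g) = act c (ψ g)`); the `ℤ_p`-span `B` of
`κ(M)` is `ψ(G)`, torsion-free; for any `M₀ ⊆ M` the `ℤ_p`-span `A` of `κ(M₀)` is `ψ(ℤ_p · Φ(M₀))`; and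

  `relIndex (tors ⊔ A) B = [G : ℤ_p · Φ(M₀)]`      (`relIndex_torsion_sup_kummerSpan_eq`).

So the local Mordell–Weil index is computed in the chart. References: B. Perrin-Riou, Bull. SMF 115
(1987) §0 p. 401 (`E(L) ⊗ ℤ_p ↪ S_p(L)`, `ℤ_p`-module structure); J. H. Silverman, *AEC* (2009) VIII.§2
(Kummer sequence), VII.6.3; cell memo `STUB-PLAN-stub_localMordellWeilDictSeven.md` (addendum (a)–(e)).
-/

set_option linter.dupNamespace false

noncomputable section

open scoped Classical

namespace Summit.BirchSwinnertonDyer.BirchSwinnertonDyer.Theorems.RamifiedSevenEllipticUnits.KummerCore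

variable {p : ℕ} [Fact p.Prime]
variable {M : Type*} [AddCommGroup M]
variable {A : ℕ → Type*} [∀ k, AddCommGroup (A k)]
variable {V : Type*} [AddCommGroup V] [Module ℤ_[p] V]

/-! ## §1 Torsion in a group without `p`-torsion is `p`-divisible -/

/-- In an additive group with no element of order `p`, the order of every torsion element is prime
to `p`. [folklore] -/
theorem coprime_addOrderOf_of_noPTorsion (hM : ∀ P : M, p • P = 0 → P = 0) {T : M}
    (hT : IsOfFinAddOrder T) : Nat.Coprime p (addOrderOf T) := by
  have hp : p.Prime := Fact.out
  rw [hp.coprime_iff_not_dvd]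
  rintro ⟨m, hm⟩
  have hpos : 0 < addOrderOf T := hT.addOrderOf_pos
  have hmT : m • T = 0 := by
    apply hM
    rw [← mul_nsmul', ← hm]
    exact addOrderOf_nsmul_eq_zero T
  have hdvd : addOrderOf T ∣ m := addOrderOf_dvd_iff_nsmul_eq_zero.mpr hmT
  have hm0 : 0 < m := by
    rcases Nat.eq_zero_or_pos m with h0 | h0
    · rw [h0, mul_zero] at hm; omega
    · exact h0
  have hle : addOrderOf T ≤ m := Nat.le_of_dvd hm0 hdvd
  have : p * m ≤ 1 * m := by rw [← hm, one_mul]; exact hle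
  have hp1 : 1 < p := hp.one_lt
  nlinarith

/-- **Torsion is `p`-divisible** in an additive commutative group with no `p`-torsion: every torsion
`T` is `p^k • R` for some `R` (Bezout: `u p^k + v·ord(T) = 1`, `R = u • T`). [folklore] -/
theorem exists_zsmul_eq_of_isOfFinAddOrder (hM : ∀ P : M, p • P = 0 → P = 0) {T : M}
    (hT : IsOfFinAddOrder T) (k : ℕ) : ∃ R : M, ((p : ℤ) ^ k) • R = T := by
  have hcop : Nat.Coprime (p ^ k) (addOrderOf T) :=
    Nat.Coprime.pow_left k (coprime_addOrderOf_of_noPTorsion hM hT)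
  obtain ⟨u, v, huv⟩ := hcop.isCoprime
  refine ⟨u • T, ?_⟩
  have hvT : (v * (addOrderOf T : ℤ)) • T = 0 := by
    rw [← smul_smul, natCast_zsmul, addOrderOf_nsmul_eq_zero, smul_zero]
  calc ((p : ℤ) ^ k) • u • T = (u * (p : ℤ) ^ k) • T := by rw [smul_smul, mul_comm]
    _ = (u * (p : ℤ) ^ k) • T + (v * (addOrderOf T : ℤ)) • T := by rw [hvT, add_zero]
    _ = T := by rw [← add_smul]; push_cast at huv; rw [huv, one_smul]

/-! ## §2 The compact Kummer map kills torsion and factors through the chart -/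

section Core

variable (κ : M →+ (Π k, A k)) (act : ℤ_[p] → (Π k, A k) →+ (Π k, A k)) (Φ : M →+ V)
  (G : Submodule ℤ_[p] V)

/-- `κ` kills torsion (level by level, `κ(P)_k = 0 ↔ P ∈ p^k M`, and torsion is `p`-divisible).
[cite: SilvermanAEC2009, VIII.§2 (the Kummer sequence)] -/
theorem kummer_eq_zero_of_isOfFinAddOrder (hM : ∀ P : M, p • P = 0 → P = 0)
    (hκ : ∀ (P : M) (k : ℕ), κ P k = 0 ↔ ∃ R : M, ((p : ℤ) ^ k) • R = P)
    {T : M} (hT : IsOfFinAddOrder T) : κ T = 0 := by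
  funext k
  rw [Pi.zero_apply, hκ]
  exact exists_zsmul_eq_of_isOfFinAddOrder hM hT k

omit [Module ℤ_[p] V] in
/-- `κ` is constant on the fibres of the chart `Φ` (`ker Φ = M_tors ⊆ ker κ`). [folklore] -/
theorem kummer_eq_of_chart_eq (hM : ∀ P : M, p • P = 0 → P = 0)
    (hκ : ∀ (P : M) (k : ℕ), κ P k = 0 ↔ ∃ R : M, ((p : ℤ) ^ k) • R = P)
    (hΦ : ∀ P : M, Φ P = 0 ↔ IsOfFinAddOrder P) {P P' : M} (h : Φ P = Φ P') : κ P = κ P' := by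
  rw [← sub_eq_zero, ← map_sub]
  rw [← sub_eq_zero, ← map_sub, hΦ] at h
  exact kummer_eq_zero_of_isOfFinAddOrder κ hM hκ h

/-- The value `(c mod p^k) ∈ ℕ` through which `c ∈ ℤ_p` acts on the `k`-th factor is `appr c k`. [folklore] -/
theorem val_toZModPow_eq_appr (k : ℕ) (c : ℤ_[p]) :
    ((PadicInt.toZModPow k c).val : ℤ_[p]) = (c.appr k : ℤ_[p]) := by
  simp [PadicInt.toZModPow, PadicInt.toZModHom, ZMod.val_natCast,
    Nat.mod_eq_of_lt (PadicInt.appr_lt c k)]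

/-- **`ℤ_p`-LINEARITY of the compact Kummer map in the chart**: if `Φ P' = c • Φ P` then
`κ P' = act c (κ P)`. At level `k`, with `a = c mod p^k ∈ ℕ`: `Φ(P' − aP) = (c − a) • Φ P ∈ p^k G =
Φ(p^k M)`, so `P' − aP ∈ p^k M + M_tors` and `κ(P')_k = κ(aP)_k = a • κ(P)_k`. Perrin-Riou 1987 §0
(the `ℤ_p`-module structure of `E(L) ⊗ ℤ_p ↪ S_p(L)`). [cite: PerrinRiou1987BSMF, §0 p. 401] -/
theorem kummer_eq_act_of_chart_eq_smul (hM : ∀ P : M, p • P = 0 → P = 0)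
    (hκ : ∀ (P : M) (k : ℕ), κ P k = 0 ↔ ∃ R : M, ((p : ℤ) ^ k) • R = P)
    (hact : ∀ (c : ℤ_[p]) (x : Π k, A k) (k : ℕ), act c x k = ((PadicInt.toZModPow k c).val : ℤ) • x k)
    (hΦ : ∀ P : M, Φ P = 0 ↔ IsOfFinAddOrder P) (hG : ∀ v : V, v ∈ G ↔ ∃ P : M, Φ P = v)
    {P P' : M} {c : ℤ_[p]} (h : Φ P' = c • Φ P) : κ P' = act c (κ P) := by
  funext k
  set a : ℕ := (PadicInt.toZModPow k c).val with ha
  rw [hact, ← ha, ← Pi.smul_apply, ← map_zsmul]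
  -- `c - a = p^k * d`
  obtain ⟨d, hd⟩ : ∃ d : ℤ_[p], c - (a : ℤ_[p]) = (p : ℤ_[p]) ^ k * d := by
    have hmem : c - (a : ℤ_[p]) ∈ Ideal.span {(p : ℤ_[p]) ^ k} := by
      rw [ha, val_toZModPow_eq_appr]
      exact PadicInt.appr_spec k c
    exact Ideal.mem_span_singleton'.mp hmem |>.imp fun d hd ↦ by rw [← hd, mul_comm]
  -- `d • Φ P = Φ R`
  have hPG : Φ P ∈ G := (hG _).2 ⟨P, rfl⟩
  obtain ⟨R, hR⟩ := (hG _).1 (G.smul_mem d hPG)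
  -- `Φ (P' - a • P - p^k • R) = 0`
  have hT : IsOfFinAddOrder (P' - (a : ℤ) • P - ((p : ℤ) ^ k) • R) := by
    rw [← hΦ, map_sub, map_sub, map_zsmul, map_zsmul, h, hR, sub_sub, sub_eq_zero,
      ← Int.cast_smul_eq_zsmul ℤ_[p], ← Int.cast_smul_eq_zsmul ℤ_[p] ((p : ℤ) ^ k), smul_smul,
      ← add_smul]
    congr 1
    push_cast
    linear_combination hd
  have hκT := congr_fun (kummer_eq_zero_of_isOfFinAddOrder κ hM hκ hT) k
  rw [map_sub, map_sub, Pi.sub_apply, Pi.sub_apply, Pi.zero_apply,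
    (hκ (((p : ℤ) ^ k) • R) k).2 ⟨R, rfl⟩, sub_zero, sub_eq_zero] at hκT
  exact hκT

/-- **Injectivity in the chart**: if `κ P = 0` then `Φ P = 0` (`P ∈ ⋂_k p^k M`, so `Φ P ∈ ⋂_k p^k V = 0`
by `p`-adic separatedness of `V`). [cite: PerrinRiou1987BSMF, §0 p. 401] -/
theorem chart_eq_zero_of_kummer_eq_zero
    (hκ : ∀ (P : M) (k : ℕ), κ P k = 0 ↔ ∃ R : M, ((p : ℤ) ^ k) • R = P)
    (hsep : ∀ v : V, (∀ k : ℕ, ∃ w : V, ((p : ℤ_[p]) ^ k) • w = v) → v = 0)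
    {P : M} (h : κ P = 0) : Φ P = 0 := by
  refine hsep _ fun k ↦ ?_
  obtain ⟨R, hR⟩ := (hκ P k).1 (by rw [h, Pi.zero_apply])
  refine ⟨Φ R, ?_⟩
  rw [← hR, map_zsmul, ← Int.cast_smul_eq_zsmul ℤ_[p]]
  push_cast
  rfl

/-- **The compact Kummer map factors through the chart**: there is an additive `ψ : G → ∏_k A_k` with
`ψ (Φ P) = κ P` for every `P` (well defined by `kummer_eq_of_chart_eq`). [folklore] -/
theorem exists_factor_hom (hM : ∀ P : M, p • P = 0 → P = 0)
    (hκ : ∀ (P : M) (k : ℕ), κ P k = 0 ↔ ∃ R : M, ((p : ℤ) ^ k) • R = P)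
    (hΦ : ∀ P : M, Φ P = 0 ↔ IsOfFinAddOrder P) (hG : ∀ v : V, v ∈ G ↔ ∃ P : M, Φ P = v) :
    ∃ ψ : G →+ (Π k, A k), ∀ (P : M) (hP : Φ P ∈ G), ψ ⟨Φ P, hP⟩ = κ P := by
  have hch : ∀ g : G, Φ (Classical.choose ((hG (g : V)).1 g.2)) = g := fun g ↦
    Classical.choose_spec ((hG (g : V)).1 g.2)
  refine ⟨{ toFun := fun g ↦ κ (Classical.choose ((hG (g : V)).1 g.2))
            map_zero' := ?_
            map_add' := fun g g' ↦ ?_ }, fun P hP ↦ ?_⟩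
  · have h0 : Φ (Classical.choose ((hG ((0 : G) : V)).1 (0 : G).2)) = Φ 0 := by
      rw [map_zero]; exact hch 0
    rw [kummer_eq_of_chart_eq κ Φ hM hκ hΦ h0, map_zero]
  · rw [← map_add]
    refine kummer_eq_of_chart_eq κ Φ hM hκ hΦ ?_
    rw [map_add, hch, hch, hch, Submodule.coe_add]
  · exact kummer_eq_of_chart_eq κ Φ hM hκ hΦ (hch ⟨Φ P, hP⟩)

end Core

/-! ## §3 The index theorem -/

section Index

variable (κ : M →+ (Π k, A k)) (act : ℤ_[p] → (Π k, A k) →+ (Π k, A k)) (Φ : M →+ V)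
  (G : Submodule ℤ_[p] V)

/-- **THE ABSTRACT COMPACT-KUMMER INDEX THEOREM.** In the situation of the module docstring (`M` with
no `p`-torsion; `κ` with level-`k` kernel `p^k M`; `act` the `ℤ_p`-action through `c mod p^k`; a chart
`Φ : M → V` into a torsion-free `p`-adically separated `ℤ_p`-module with `ker Φ = M_tors` and
`range Φ = G` a `ℤ_p`-submodule), for every subset `M₀ ⊆ M`: with `B` the subgroup of `∏_k A_k` generated
by the `act c (κ P)` (`P ∈ M`, `c ∈ ℤ_p`) and `A` the one generated by the `act c (κ P)` with `P ∈ M₀`,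

  `relIndex (tors(∏_k A_k) ⊔ A) B = relIndex (ℤ_p · Φ(M₀)) G`.

(`B = ψ(G)` is torsion-free and `A = ψ(ℤ_p · Φ(M₀))` for the injective `ℤ_p`-linear factorisation `ψ`
of `κ` through `Φ`; indices are transported along `ψ`.) For `M = E(K_𝔭)`, `M₀ =` the image of
`E(K)`, this computes the local Mordell–Weil index exponent `m_loc` of the K7r dictionary in the chart.
[cite: PerrinRiou1987BSMF, §0 p. 401] [cite: SilvermanAEC2009, VIII.§2 and Prop. VII.6.3] -/
theorem relIndex_torsion_sup_kummerSpan_eq [NoZeroSMulDivisors ℤ_[p] V]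
    (hM : ∀ P : M, p • P = 0 → P = 0)
    (hκ : ∀ (P : M) (k : ℕ), κ P k = 0 ↔ ∃ R : M, ((p : ℤ) ^ k) • R = P)
    (hact : ∀ (c : ℤ_[p]) (x : Π k, A k) (k : ℕ), act c x k = ((PadicInt.toZModPow k c).val : ℤ) • x k)
    (hΦ : ∀ P : M, Φ P = 0 ↔ IsOfFinAddOrder P) (hG : ∀ v : V, v ∈ G ↔ ∃ P : M, Φ P = v)
    (hsep : ∀ v : V, (∀ k : ℕ, ∃ w : V, ((p : ℤ_[p]) ^ k) • w = v) → v = 0) (M₀ : Set M) :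
    (AddCommGroup.torsion (Π k, A k) ⊔
        AddSubgroup.closure {x | ∃ P ∈ M₀, ∃ c : ℤ_[p], x = act c (κ P)}).relIndex
      (AddSubgroup.closure {x | ∃ (P : M) (c : ℤ_[p]), x = act c (κ P)}) =
    (Submodule.span ℤ_[p] (Φ '' M₀)).toAddSubgroup.relIndex G.toAddSubgroup := by
  -- the factorisation `ψ`
  obtain ⟨ψ, hψ⟩ := exists_factor_hom κ Φ G hM hκ hΦ hG
  have hmemG : ∀ P : M, Φ P ∈ G := fun P ↦ (hG _).2 ⟨P, rfl⟩
  have hsurj : ∀ g : G, ∃ P : M, (⟨Φ P, hmemG P⟩ : G) = g := fun g ↦ by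
    obtain ⟨P, hP⟩ := (hG (g : V)).1 g.2
    exact ⟨P, Subtype.ext hP⟩
  -- `ψ` is `ℤ_p`-linear
  have hlin : ∀ (g : G) (c : ℤ_[p]), ψ (c • g) = act c (ψ g) := by
    intro g c
    obtain ⟨P, rfl⟩ := hsurj g
    obtain ⟨P', hP'⟩ := (hG (c • Φ P)).1 (G.smul_mem c (hmemG P))
    have hcg : c • (⟨Φ P, hmemG P⟩ : G) = ⟨Φ P', hmemG P'⟩ := Subtype.ext (by
      show c • Φ P = Φ P'
      exact hP'.symm)
    rw [hcg, hψ, hψ]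
    exact kummer_eq_act_of_chart_eq_smul κ act Φ G hM hκ hact hΦ hG hP'
  -- `ψ` is injective
  have hinj : Function.Injective ψ := by
    refine (injective_iff_map_eq_zero ψ).2 fun g hg ↦ ?_
    obtain ⟨P, rfl⟩ := hsurj g
    rw [hψ] at hg
    exact Subtype.ext (chart_eq_zero_of_kummer_eq_zero κ Φ hκ hsep hg)
  -- `κ P = act 1 (κ P)`
  have hone : ∀ P : M, κ P = act 1 (κ P) := fun P ↦
    kummer_eq_act_of_chart_eq_smul κ act Φ G hM hκ hact hΦ hG (P := P) (P' := P) (c := 1)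
      (by rw [one_smul])
  -- `B = ψ(G)`
  set B := AddSubgroup.closure {x | ∃ (P : M) (c : ℤ_[p]), x = act c (κ P)} with hBdef
  have hB : B = (⊤ : AddSubgroup G).map ψ := by
    apply le_antisymm
    · rw [hBdef, AddSubgroup.closure_le]
      rintro x ⟨P, c, rfl⟩
      refine AddSubgroup.mem_map.2 ⟨c • ⟨Φ P, hmemG P⟩, AddSubgroup.mem_top _, ?_⟩
      rw [hlin, hψ]
    · intro x hx
      obtain ⟨g, -, rfl⟩ := AddSubgroup.mem_map.1 hx
      obtain ⟨P, rfl⟩ := hsurj g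
      rw [hψ, hone P]
      exact AddSubgroup.subset_closure ⟨P, 1, rfl⟩
  -- `A = ψ(ℤ_p Φ(M₀))`
  set Z : AddSubgroup G :=
    (Submodule.span ℤ_[p] (Φ '' M₀)).toAddSubgroup.addSubgroupOf G.toAddSubgroup with hZdef
  set A' := AddSubgroup.closure {x | ∃ P ∈ M₀, ∃ c : ℤ_[p], x = act c (κ P)} with hA'def
  have hA : A' = Z.map ψ := by
    apply le_antisymm
    · rw [hA'def, AddSubgroup.closure_le]
      rintro x ⟨P, hP, c, rfl⟩
      refine AddSubgroup.mem_map.2 ⟨c • ⟨Φ P, hmemG P⟩, ?_, ?_⟩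
      · show c • Φ P ∈ Submodule.span ℤ_[p] (Φ '' M₀)
        exact Submodule.smul_mem _ c (Submodule.subset_span ⟨P, hP, rfl⟩)
      · rw [hlin, hψ]
    · intro x hx
      obtain ⟨g, hg, rfl⟩ := AddSubgroup.mem_map.1 hx
      replace hg : (g : V) ∈ Submodule.span ℤ_[p] (Φ '' M₀) := hg
      -- induction on the span, carrying an arbitrary scalar
      have key : ∀ (v : V) (_ : v ∈ Submodule.span ℤ_[p] (Φ '' M₀)) (c : ℤ_[p]) (hv : c • v ∈ G),
          ψ ⟨c • v, hv⟩ ∈ A' := by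
        intro v hv
        induction hv using Submodule.span_induction with
        | mem v hv =>
          intro c hcv
          obtain ⟨P, hP, rfl⟩ := hv
          have : (⟨c • Φ P, hcv⟩ : G) = c • ⟨Φ P, hmemG P⟩ := Subtype.ext rfl
          rw [this, hlin, hψ]
          exact AddSubgroup.subset_closure ⟨P, hP, c, rfl⟩
        | zero =>
          intro c hc
          have : (⟨c • (0 : V), hc⟩ : G) = 0 := Subtype.ext (smul_zero c)
          rw [this, map_zero]
          exact A'.zero_mem
        | add v w hv hw ihv ihw =>
          intro c hc
          have hvG : c • v ∈ G := G.smul_mem c (Submodule.span_le.2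
            (by rintro _ ⟨P, -, rfl⟩; exact hmemG P) hv)
          have hwG : c • w ∈ G := G.smul_mem c (Submodule.span_le.2
            (by rintro _ ⟨P, -, rfl⟩; exact hmemG P) hw)
          have : (⟨c • (v + w), hc⟩ : G) = ⟨c • v, hvG⟩ + ⟨c • w, hwG⟩ :=
            Subtype.ext (smul_add c v w)
          rw [this, map_add]
          exact A'.add_mem (ihv c hvG) (ihw c hwG)
        | smul a v hv ih =>
          intro c hc
          have h' : (c * a) • v ∈ G := by rw [mul_smul]; exact hc
          have : (⟨c • a • v, hc⟩ : G) = ⟨(c * a) • v, h'⟩ := Subtype.ext (smul_smul c a v)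
          rw [this]
          exact ih (c * a) h'
      have h1 : (1 : ℤ_[p]) • (g : V) ∈ G := by rw [one_smul]; exact g.2
      have : g = ⟨(1 : ℤ_[p]) • (g : V), h1⟩ := Subtype.ext (one_smul ℤ_[p] (g : V)).symm
      rw [this]
      exact key _ hg 1 h1
  -- `B` is torsion-free
  have htf : AddCommGroup.torsion (Π k, A k) ⊓ B = ⊥ := by
    rw [eq_bot_iff]
    intro x hx'
    obtain ⟨hx, hxB⟩ := AddSubgroup.mem_inf.1 hx'
    rw [hB] at hxB
    obtain ⟨g, -, rfl⟩ := AddSubgroup.mem_map.1 hxB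
    rw [AddCommGroup.mem_torsion, isOfFinAddOrder_iff_nsmul_eq_zero] at hx
    obtain ⟨n, hn, hng⟩ := hx
    rw [← map_nsmul, ← (map_zero ψ)] at hng
    have hng' : n • g = 0 := hinj hng
    have hg0 : g = 0 := by
      have h2 : ((n : ℤ_[p]) • g) = 0 := by rw [Nat.cast_smul_eq_nsmul]; exact hng'
      rcases smul_eq_zero.mp h2 with h | h
      · exact absurd h (Nat.cast_ne_zero.mpr hn.ne')
      · exact h
    rw [AddSubgroup.mem_bot, hg0, map_zero]
  -- modular step: `(tors ⊔ A) ⊓ B = A ⊓ B`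
  have hAB : A' ≤ B := by
    rw [hA, hB]
    exact AddSubgroup.map_mono le_top
  have hmod : (AddCommGroup.torsion (Π k, A k) ⊔ A') ⊓ B = A' ⊓ B := by
    apply le_antisymm
    · intro x hx'
      obtain ⟨hx, hxB⟩ := AddSubgroup.mem_inf.1 hx'
      obtain ⟨t, ht, a, ha, rfl⟩ := AddSubgroup.mem_sup.1 hx
      have htB : t ∈ B := by
        have : t = (t + a) - a := (add_sub_cancel_right t a).symm
        rw [this]
        exact B.sub_mem hxB (hAB ha)
      have ht0 : t = 0 := by
        have : t ∈ AddCommGroup.torsion (Π k, A k) ⊓ B := AddSubgroup.mem_inf.2 ⟨ht, htB⟩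
        rwa [htf, AddSubgroup.mem_bot] at this
      rw [ht0, zero_add]
      exact AddSubgroup.mem_inf.2 ⟨ha, hAB ha⟩
    · exact inf_le_inf_right B le_sup_right
  -- transport the index along `ψ`
  calc (AddCommGroup.torsion (Π k, A k) ⊔ A').relIndex B
      = ((AddCommGroup.torsion (Π k, A k) ⊔ A') ⊓ B).relIndex B :=
        (AddSubgroup.inf_relIndex_right _ _).symm
    _ = (A' ⊓ B).relIndex B := by rw [hmod]
    _ = A'.relIndex B := AddSubgroup.inf_relIndex_right _ _
    _ = (Z.map ψ).relIndex ((⊤ : AddSubgroup G).map ψ) := by rw [hA, hB]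
    _ = Z.relIndex ⊤ := AddSubgroup.relIndex_map_map_of_injective _ _ hinj
    _ = Z.index := AddSubgroup.relIndex_top_right _
    _ = (Submodule.span ℤ_[p] (Φ '' M₀)).toAddSubgroup.relIndex G.toAddSubgroup := rfl

end Index

end Summit.BirchSwinnertonDyer.BirchSwinnertonDyer.Theorems.RamifiedSevenEllipticUnits.KummerCore

end
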